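import Mathlib
import Literature.AlgebraicGeometry.Resolution.LocalBlowup
import Literature.AlgebraicGeometry.Resolution.ExcellentRings
import Literature.AlgebraicGeometry.Resolution.ExcellentRingsFieldProofs
import Literature.AlgebraicGeometry.Resolution.ExcellentRingsEssFiniteType
import Literature.AlgebraicGeometry.Resolution.WeightedBlowupMonomialValuation
import Literature.RingTheory.KrullDimension.HomogeneousCommonZero
import HarnessLib

/-!
# The divisorial witness base for F-110: `S = 𝔽_p[x,y,w]_{(x,y,w)}`, `f = x²y`, `O = ord_𝔪`

Support file (INPUTS seat res-inputs-p-cp15frame g1, 2026-08-28) for the negative lemmas on the RETIRED statement F-110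
`Literature.AlgebraicGeometry.CossartPiltant200819.CossartPiltant2019_thm_1_5_i_frame` (crux `CleanModels`,
stmt-ResolutionOfSingularities-15917, stub `stub_cp2019Thm15iFrame`).  It builds IN LEAN the base of the divisorial witness of
res-inputs-crit-1 R190 (3) (and of the golden witness of res-B-lens-6 g3 / res-B-crit-1, which has the same `S`, `K`, `f`):

* `OrdWitness.Poly p = 𝔽_p[X₀,X₁,X₂]`, `OrdWitness.origin p = ker (constantCoeff) = (X₀,X₁,X₂)`,
  `OrdWitness.S p = (Poly p)_{origin}` (a `Localization.AtPrime`), `OrdWitness.K p = Frac (Poly p)`,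
  `OrdWitness.f p = X₀²X₁ ∈ S p`;
* `OrdWitness.ordV p` — the `𝔪`-ADIC ORDER of `𝔽_p[X₀,X₁,X₂]` as a `ℤᵐ⁰`-valued Mathlib `Valuation` (`F ↦ exp (−ord F)`, from
  the tree's monomial valuation `WeightedBlowup.monomialOrd` with all weights `1`, i.e. Mathlib's `MvPowerSeries.order`),
  `OrdWitness.ordVK p` its extension to `K`, and `OrdWitness.O p : ValuationSubring (K p)` — the divisorial valuation ring
  `ord_𝔪` of the blown-up origin;
* ALL HYPOTHESES OF F-110 AT THIS DATA, proved: `S p` is a regular local ring (`Polynomial ring over a field is regular`,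
  Mathlib), excellent (`isExcellentRing_of_finiteType_field` + `IsExcellentRing.of_isLocalization`, tree theorems — NOT named
  facts), of Krull dimension `3` (`height (X₀,X₁,X₂) = 3`, tree), of characteristic `p`; `K p` is its fraction field;
  `f = X₀²X₁` is not a `p`-th power in `K` for `p ≠ 3` (its order `3` is not a multiple of `p`); `S ≤ O` and `O` dominates `S`
  (`ord > 0` on `𝔪_S`);
* companion file `CossartPiltant2019Thm15iFrameFalseOfOrdTowerShape.lean`: the order bookkeeping on the affine `K^p`-line
  (`ord (C^p·f + D^p) ≠ 1`), the domination of tower members, the reduced hypotheses `OrdFrameTowersCritical` /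
  `OrdTowerShape` (res-inputs-crit-1 R190 (3)'s three-ring classification, NOT proved) and the negative lemmas modulo them.

Nothing here proves or refutes resolution of singularities in characteristic `p`; [OURS · NEGATIVE-SUPPORT] counted 0.
-/

noncomputable section

set_option linter.dupNamespace false -- mandated namespace of this single-conjunct summit

open MvPolynomial IsLocalRing
open Literature.AlgebraicGeometry.Resolution Literature.AlgebraicGeometry.Resolution.WeightedBlowup

namespace Summit.ResolutionOfSingularities.ResolutionOfSingularities.Theorems.CleanModels.Negative

namespace OrdWitness

variable (p : ℕ) [hp : Fact p.Prime]

/-! ## 1. The data -/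

/-- `𝔽_p[X₀, X₁, X₂]`. [folklore] -/
abbrev Poly : Type := MvPolynomial (Fin 3) (ZMod p)

/-- The ideal `(X₀, X₁, X₂)` of the origin: polynomials with zero constant coefficient. [folklore] -/
abbrev origin : Ideal (Poly p) := RingHom.ker (constantCoeff : Poly p →+* ZMod p)

/-- The origin is a maximal ideal. [folklore] -/
theorem origin_isMaximal : (origin p).IsMaximal :=
  RingHom.ker_isMaximal_of_surjective _ fun c => ⟨C c, constantCoeff_C _ c⟩

/-- `S = 𝔽_p[X₀,X₁,X₂]_{(X₀,X₁,X₂)}`, the regular local ring of the origin of affine 3-space. [folklore] -/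
abbrev S : Type := Localization.AtPrime (origin p)

/-- `K = 𝔽_p(X₀,X₁,X₂)`. [folklore] -/
abbrev K : Type := FractionRing (Poly p)

/-- `f = X₀² X₁ ∈ S`, the radicand of the witness. [folklore] -/
def f : S p := algebraMap (Poly p) (S p) (X 0 ^ 2 * X 1)

/-! ## 2. The `𝔪`-adic order as a `ℤᵐ⁰`-valued valuation -/

/-- The total-degree order `ord F = min {|d| : coeff_d F ≠ 0} ∈ ℕ∞` of a polynomial (`⊤` for `0`): the tree's monomial
valuation with all weights `1`. [folklore] -/
abbrev ord (F : Poly p) : ℕ∞ := monomialOrd (fun _ : Fin 3 => (1 : ℕ)) F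

/-- `exp (−n) ∈ ℤᵐ⁰`. [folklore] -/
def expNeg (n : ℕ) : WithZero (Multiplicative ℤ) :=
  ((Multiplicative.ofAdd (-(n : ℤ)) : Multiplicative ℤ) : WithZero (Multiplicative ℤ))

omit hp in
/-- `exp (−(m+n)) = exp (−m) · exp (−n)`. [folklore] -/
theorem expNeg_add (m n : ℕ) : expNeg (m + n) = expNeg m * expNeg n := by
  rw [expNeg, expNeg, expNeg, ← WithZero.coe_mul, ← ofAdd_add]
  congr 2
  push_cast
  ring

omit hp in
/-- `exp (−m) ≤ exp (−n) ⟺ n ≤ m`. [folklore] -/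
theorem expNeg_le_expNeg {m n : ℕ} : expNeg m ≤ expNeg n ↔ n ≤ m := by
  rw [expNeg, expNeg, WithZero.coe_le_coe, Multiplicative.ofAdd_le]
  omega

omit hp in
/-- `exp (−n) ≠ 0`. [folklore] -/
theorem expNeg_ne_zero (n : ℕ) : expNeg n ≠ 0 := WithZero.coe_ne_zero

omit hp in
/-- `exp (−n) ≤ 1`. [folklore] -/
theorem expNeg_le_one (n : ℕ) : expNeg n ≤ 1 := by
  rw [expNeg, ← WithZero.coe_one, WithZero.coe_le_coe, ← ofAdd_zero, Multiplicative.ofAdd_le]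
  omega

omit hp in
/-- `exp (−n) < 1 ⟺ 0 < n`. [folklore] -/
theorem expNeg_lt_one_iff {n : ℕ} : expNeg n < 1 ↔ 0 < n := by
  rw [expNeg, ← WithZero.coe_one, WithZero.coe_lt_coe, ← ofAdd_zero, Multiplicative.ofAdd_lt]
  omega

omit hp in
/-- `exp (−0) = 1`. [folklore] -/
theorem expNeg_zero : expNeg 0 = 1 := by
  rw [expNeg, Nat.cast_zero, neg_zero, ofAdd_zero, WithZero.coe_one]

/-- `ord F = ⊤ ⟺ F = 0`. [folklore] -/
theorem ord_ne_top {F : Poly p} (hF : F ≠ 0) : ord p F ≠ ⊤ := by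
  rw [ne_eq, monomialOrd_eq_top_iff]
  exact hF

/-- **The `𝔪`-adic order valuation `F ↦ exp (−ord F)` of `𝔽_p[X₀,X₁,X₂]`** (multiplicative: `ord (FG) = ord F + ord G`
over a domain, `ord (F + G) ≥ min`). [folklore] -/
def ordV : Valuation (Poly p) (WithZero (Multiplicative ℤ)) where
  toFun F := if F = 0 then 0 else expNeg (ord p F).toNat
  map_zero' := if_pos rfl
  map_one' := by
    rw [if_neg one_ne_zero]
    have h1 : ord p (1 : Poly p) = 0 := by
      rw [← C_1]
      exact monomialOrd_C _ one_ne_zero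
    rw [h1, ENat.toNat_zero, expNeg, Nat.cast_zero, neg_zero, ofAdd_zero, WithZero.coe_one]
  map_mul' F G := by
    by_cases hF : F = 0
    · simp [hF]
    by_cases hG : G = 0
    · simp [hG]
    rw [if_neg (mul_ne_zero hF hG), if_neg hF, if_neg hG, ← expNeg_add]
    congr 1
    rw [show ord p (F * G) = ord p F + ord p G from monomialOrd_mul _ F G,
      ENat.toNat_add (ord_ne_top p hF) (ord_ne_top p hG)]
  map_add_le_max' F G := by
    by_cases hFG : F + G = 0
    · rw [if_pos hFG]; exact zero_le
    by_cases hF : F = 0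
    · subst hF; simp
    by_cases hG : G = 0
    · subst hG; simp
    rw [if_neg hFG, if_neg hF, if_neg hG]
    have key := min_monomialOrd_le_add (fun _ : Fin 3 => (1 : ℕ)) F G
    obtain ⟨a, ha⟩ := ENat.ne_top_iff_exists.mp (ord_ne_top p hF)
    obtain ⟨b, hb⟩ := ENat.ne_top_iff_exists.mp (ord_ne_top p hG)
    obtain ⟨c, hc⟩ := ENat.ne_top_iff_exists.mp (ord_ne_top p hFG)
    change min (ord p F) (ord p G) ≤ ord p (F + G) at key
    rw [← ha, ← hb, ← hc] at key
    rw [show ord p F = a from ha.symm, show ord p G = b from hb.symm, show ord p (F + G) = c from hc.symm]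
    simp only [ENat.toNat_coe]
    rcases le_total a b with h | h
    · have hab : (a : ℕ∞) ≤ b := by exact_mod_cast h
      rw [min_eq_left hab] at key
      have key' : a ≤ c := by exact_mod_cast key
      exact le_max_of_le_left (expNeg_le_expNeg.mpr key')
    · have hab : (b : ℕ∞) ≤ a := by exact_mod_cast h
      rw [min_eq_right hab] at key
      have key' : b ≤ c := by exact_mod_cast key
      exact le_max_of_le_right (expNeg_le_expNeg.mpr key')

/-- Unfolding `ordV`. [folklore] -/
theorem ordV_apply (F : Poly p) : ordV p F = if F = 0 then 0 else expNeg (ord p F).toNat := rfl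

/-- `ordV F = exp (−n)` when `ord F = n`. [folklore] -/
theorem ordV_eq_expNeg {F : Poly p} (hF : F ≠ 0) {n : ℕ} (hn : ord p F = n) : ordV p F = expNeg n := by
  rw [ordV_apply, if_neg hF, hn, ENat.toNat_coe]

/-- `ordV F ≤ 1` for every polynomial. [folklore] -/
theorem ordV_le_one (F : Poly p) : ordV p F ≤ 1 := by
  rw [ordV_apply]
  split_ifs
  · exact zero_le
  · exact expNeg_le_one _

/-- A polynomial with nonzero constant coefficient has order `0`, value `1`. [folklore] -/
theorem ordV_eq_one_of_not_mem {F : Poly p} (hF : F ∉ origin p) : ordV p F = 1 := by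
  have hF0 : F ≠ 0 := by rintro rfl; exact hF (by simp)
  have h0 : coeff 0 F ≠ 0 := fun h => hF (by rw [RingHom.mem_ker]; exact h)
  have hord : ord p F = 0 := by
    have := monomialOrd_le_weight (fun _ : Fin 3 => (1 : ℕ)) (F := F) (d := 0) (by simpa using h0)
    apply nonpos_iff_eq_zero.mp
    simpa using this
  rw [ordV_eq_expNeg p hF0 (n := 0) (by exact_mod_cast hord), expNeg, Nat.cast_zero, neg_zero, ofAdd_zero,
    WithZero.coe_one]

/-- A nonzero polynomial without constant term has value `< 1` (order `≥ 1`); `0` has value `0 < 1`. [folklore] -/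
theorem ordV_lt_one_of_mem {F : Poly p} (hF : F ∈ origin p) : ordV p F < 1 := by
  by_cases hF0 : F = 0
  · rw [ordV_apply, if_pos hF0]; exact zero_lt_one
  obtain ⟨n, hn⟩ := ENat.ne_top_iff_exists.mp (ord_ne_top p hF0)
  rw [ordV_eq_expNeg p hF0 hn.symm, expNeg_lt_one_iff]
  by_contra h0
  have hn0 : n = 0 := by omega
  subst hn0
  -- order `0` means the constant coefficient is nonzero
  obtain ⟨d, hd, hdw⟩ := exists_weight_eq_monomialOrd (fun _ : Fin 3 => (1 : ℕ)) hF0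
  have hdw' : (Finsupp.weight (fun _ : Fin 3 => (1 : ℕ)) d : ℕ∞) = ((0 : ℕ) : ℕ∞) := hdw.trans hn.symm
  have hd0 : Finsupp.weight (fun _ : Fin 3 => (1 : ℕ)) d = 0 := by exact_mod_cast hdw'
  have hdz : d = 0 := by
    rw [Finsupp.weight_apply, Finsupp.sum, Finset.sum_eq_zero_iff] at hd0
    ext i
    by_cases hi : i ∈ d.support
    · simpa using hd0 i hi
    · simpa using hi
  subst hdz
  rw [RingHom.mem_ker] at hF
  exact (mem_support_iff.mp hd) hF

/-- `ordV (X₀² X₁) = exp (−3)`. [folklore] -/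
theorem ordV_X0sq_X1 : ordV p (X 0 ^ 2 * X 1 : Poly p) = expNeg 3 := by
  have hne : (X 0 ^ 2 * X 1 : Poly p) ≠ 0 :=
    mul_ne_zero (pow_ne_zero _ (X_ne_zero _)) (X_ne_zero _)
  apply ordV_eq_expNeg p hne
  change monomialOrd _ _ = _
  rw [monomialOrd_mul, show (X 0 ^ 2 : Poly p) = X 0 * X 0 from sq _, monomialOrd_mul, monomialOrd_X, monomialOrd_X]
  norm_num

/-- The support of `ordV` is `0`: the non-zero-divisors avoid it. [folklore] -/
theorem nonZeroDivisors_le_supp_primeCompl : nonZeroDivisors (Poly p) ≤ (ordV p).supp.primeCompl := by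
  intro s hs
  change s ∉ (ordV p).supp
  rw [Valuation.mem_supp_iff, ordV_apply, if_neg (nonZeroDivisors.ne_zero hs)]
  exact expNeg_ne_zero _

/-- **`ord_𝔪` on `K = 𝔽_p(X₀,X₁,X₂)`**: the extension of `ordV` to the fraction field. [folklore] -/
def ordVK : Valuation (K p) (WithZero (Multiplicative ℤ)) :=
  (ordV p).extendToLocalization (nonZeroDivisors_le_supp_primeCompl p) (K p)

/-- `ordVK` extends `ordV`. [folklore] -/
theorem ordVK_algebraMap (F : Poly p) : ordVK p (algebraMap (Poly p) (K p) F) = ordV p F :=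
  Valuation.extendToLocalization_apply_map_apply _ _ _ F

/-- **`O = ord_𝔪`**, the divisorial valuation ring of the blown-up origin, inside `K`. [folklore] -/
def O : ValuationSubring (K p) := (ordVK p).valuationSubring

/-- Membership in `O`: `x ∈ O ⟺ ordVK x ≤ 1`. [folklore] -/
theorem mem_O_iff (x : K p) : x ∈ O p ↔ ordVK p x ≤ 1 := Valuation.mem_valuationSubring_iff _ x

/-! ## 3. The hypotheses of F-110 at the witness -/

/-- `S` is a regular local ring (localisation of a polynomial ring over a field). [folklore] -/
theorem isRegularLocalRing_S : IsRegularLocalRing (S p) := inferInstance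

/-- `S` is excellent (finite type over a field, localised — tree theorems, no named fact). [folklore] -/
theorem isExcellentRing_S : IsExcellentRing (S p) :=
  IsExcellentRing.of_isLocalization (A := Poly p) (B := S p) (origin p).primeCompl
    (isExcellentRing_of_finiteType_field (ZMod p) (Poly p))

/-- `dim S = 3` (`height (X₀,X₁,X₂) = 3`). [folklore] -/
theorem ringKrullDim_S : ringKrullDim (S p) = 3 := by
  rw [IsLocalization.AtPrime.ringKrullDim_eq_height (origin p) (S p),
    Literature.RingTheory.KrullDimension.height_ker_constantCoeff 3]
  rfl

/-- `char S = p`. [folklore] -/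
theorem charP_S : CharP (S p) p :=
  charP_of_injective_algebraMap (IsLocalization.injective (S p) (origin p).primeCompl_le_nonZeroDivisors) p

/-- `char K = p`. [folklore] -/
theorem charP_K : CharP (K p) p :=
  charP_of_injective_algebraMap (IsFractionRing.injective (Poly p) (K p)) p

/-- Every element of `S` has value `≤ 1`, and `s ∈ S` maps into `𝔪_S` iff … : the valuation of `a/t` is `ordV a`
for `t ∉ (X₀,X₁,X₂)`. [folklore] -/
theorem ordVK_mk' (a : Poly p) (t : (origin p).primeCompl) :
    ordVK p (algebraMap (S p) (K p) (IsLocalization.mk' (S p) a t)) = ordV p a := by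
  have ht : ordV p (t : Poly p) = 1 := ordV_eq_one_of_not_mem p t.2
  have hspec : IsLocalization.mk' (S p) a t * algebraMap (Poly p) (S p) t = algebraMap (Poly p) (S p) a :=
    IsLocalization.mk'_spec (S p) a t
  have h2 : algebraMap (S p) (K p) (IsLocalization.mk' (S p) a t) * algebraMap (Poly p) (K p) t =
      algebraMap (Poly p) (K p) a := by
    rw [IsScalarTower.algebraMap_apply (Poly p) (S p) (K p) (t : Poly p),
      IsScalarTower.algebraMap_apply (Poly p) (S p) (K p) a, ← map_mul, hspec]
  have h3 := congr_arg (ordVK p) h2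
  rw [map_mul, ordVK_algebraMap, ordVK_algebraMap, ht, mul_one] at h3
  exact h3

/-- `S ≤ O`. [folklore] -/
theorem range_le_O : (algebraMap (S p) (K p)).range ≤ (O p).toSubring := by
  rintro x ⟨s, rfl⟩
  obtain ⟨⟨a, t⟩, rfl⟩ := IsLocalization.mk'_surjective (origin p).primeCompl s
  change algebraMap (S p) (K p) (IsLocalization.mk' (S p) a t) ∈ O p
  rw [mem_O_iff, ordVK_mk']
  exact ordV_le_one p a

/-- `O` dominates `S`: every element of `𝔪_S` has value `< 1`. [folklore] -/
theorem dominates (s : S p) (hs : s ∈ maximalIdeal (S p)) :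
    (O p).valuation (algebraMap (S p) (K p) s) < 1 := by
  change (ordVK p).valuationSubring.valuation (algebraMap (S p) (K p) s) < 1
  rw [← (Valuation.isEquiv_valuation_valuationSubring (ordVK p)).lt_one_iff_lt_one]
  obtain ⟨⟨a, t⟩, rfl⟩ := IsLocalization.mk'_surjective (origin p).primeCompl s
  change IsLocalization.mk' (S p) a t ∈ maximalIdeal (S p) at hs
  rw [IsLocalization.AtPrime.mk'_mem_maximal_iff (S p) (origin p) a t] at hs
  change ordVK p (algebraMap (S p) (K p) (IsLocalization.mk' (S p) a t)) < 1
  rw [ordVK_mk']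
  exact ordV_lt_one_of_mem p hs

/-- The image of `f = X₀²X₁` in `K` has value `exp (−3)`. [folklore] -/
theorem ordVK_f : ordVK p (algebraMap (S p) (K p) (f p)) = expNeg 3 := by
  rw [f, ← IsScalarTower.algebraMap_apply, ordVK_algebraMap, ordV_X0sq_X1]

/-- `f = X₀²X₁` is not a `p`-th power in `K` when `p ≠ 3` (its order `3` is not a multiple of `p`). [folklore] -/
theorem f_not_pow (hp3 : p ≠ 3) (c : K p) : c ^ p ≠ algebraMap (S p) (K p) (f p) := by
  intro h
  have h1 := congr_arg (ordVK p) h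
  rw [map_pow, ordVK_f] at h1
  have hpr : p.Prime := hp.out
  rcases eq_or_ne (ordVK p c) 0 with h0 | h0
  · rw [h0, zero_pow hpr.ne_zero] at h1
    exact (expNeg_ne_zero 3) h1.symm
  · obtain ⟨z, hz⟩ := WithZero.ne_zero_iff_exists.mp h0
    rw [← hz, ← WithZero.coe_pow, expNeg, WithZero.coe_inj] at h1
    have h2 := congr_arg Multiplicative.toAdd h1
    rw [toAdd_pow, toAdd_ofAdd, nsmul_eq_mul] at h2
    -- `p • z.toAdd = -3`: impossible for a prime `p ≠ 3`
    have h2' : (p : ℤ) * Multiplicative.toAdd z = -3 := by simpa using h2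
    have h3 : (p : ℤ) ∣ 3 := ⟨-(Multiplicative.toAdd z), by rw [mul_neg, h2']; norm_num⟩
    have h4 : p ∣ 3 := by exact_mod_cast h3
    rcases (Nat.dvd_prime Nat.prime_three).mp h4 with h5 | h5
    · exact hpr.one_lt.ne' h5
    · exact hp3 h5

end OrdWitness

end Summit.ResolutionOfSingularities.ResolutionOfSingularities.Theorems.CleanModels.Negative

end
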